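import Literature.Computability.MetaComplexity.NWGenerator
import Literature.Computability.Cryptography.GoldreichLevinDirectProduct
import Literature.Computability.Complexity.DirectProductDecoding
import HarnessLib

/-!
# Steps towards `cikk_natural_implies_learning`: from the NW predictor to the GL predictor

Sixth instalment of the decomposition of the named fact
`Literature.Computability.Learning.cikk_natural_implies_learning` (CIKK 2016, Thm. 5.1). Glue
between the NW reconstruction (`NWGenerator.lean`), the Goldreich–Levin step
(`GoldreichLevinDirectProduct.lean`) and the direct-product decoder (`DirectProduct*.lean`),
all in exact counting form:

* `card_goodAdvice_ge` — **the NW reconstruction succeeds with noticeable probability**: for a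
  uniformly random block `i` and advice `(z, w)`, the NW predictor has agreement
  `≥ 1/2 + adv/(2L)` with probability `≥ adv/(2L)` (reverse Markov on
  `sum_predictorAgreement_div`; CIKK Thm. 2.11: "will produce, with probability at least
  `1/poly(L)`, a circuit computing `f` on at least `1/2 + Ω(1/L)`").
* `ampFn f k` — **the amplified function** `AMP(f) = (f^k)^{GL}` of CIKK Thm. 4.3 as a Boolean
  function on the bit positions `AmpIdx n k = (Fin k × Fin n) ⊕ Fin k` (`k` blocks of `n` bits,
  then the `k` mask bits), with the coordinate equivalence `ampEquiv` to pairs (tuple, mask) and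
  `card_agree_ampFn_eq`: the agreement count of a Boolean predictor `h` with `AMP(f)` equals the
  count of pairs on which `boolToZMod ∘ h ∘ ampEquiv.symm` predicts the GL bit `dpGL f`
  (the hypothesis of `card_goodSeedGuess_ge`).
* `card_filter_prod_ge_mul` — chaining conditional abundance statements over product spaces.

## References

* M. Carmosino, R. Impagliazzo, V. Kabanets, A. Kolokolova, *Learning algorithms from natural
  proofs*, CCC 2016, Thm. 2.11, Thm. 4.3 (definition of `AMP(f)`), Claim 4.4
  [CarmosinoImpagliazzoKabanetsKolokolova2016].
-/

open Finset Matrix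

namespace Literature.Computability.Learning

open Literature.Computability.MetaComplexity Literature.Computability.Cryptography
  Literature.Computability.Complexity

/-! ### The NW predictor is good with noticeable probability -/

section NW

variable {α β : Type*} [Fintype α] [DecidableEq α] [Fintype β] [DecidableEq β] {L : ℕ}

/-- **NW reconstruction succeeds with probability `≥ adv/(2L)`** (CIKK Thm. 2.11, the
"`1/poly(L)`" success probability, exact form): if `D` has advantage `≥ adv ≥ 0` against the NW
generator of `f`, then for at least an `adv/(2L)` fraction of the triples (block `i`, seed part
`z`, hybrid bits `w`) the NW predictor agrees with `f` on at least a `1/2 + adv/(2L)` fraction of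
the inputs. [cite: CarmosinoImpagliazzoKabanetsKolokolova2016, Thm. 2.11] -/
theorem card_goodAdvice_ge (e : Fin L → (β ↪ α)) (f : (β → Bool) → Bool)
    (D : (Fin L → Bool) → Bool) (hL : 0 < L) {adv : ℝ} (hadv0 : 0 ≤ adv)
    (hadv : adv ≤ advantage D (nwGenerator e f)) :
    adv / (2 * L) * Fintype.card (Fin L × ((α → Bool) × (Fin L → Bool))) ≤
      ((univ.filter fun t : Fin L × ((α → Bool) × (Fin L → Bool)) =>
        1 / 2 + adv / (2 * L) ≤ agreement (nwPredictor e f D t.1 t.2.1 t.2.2) f).card : ℝ) := by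
  classical
  have hL' : (0 : ℝ) < L := Nat.cast_pos.2 hL
  set Ω := (α → Bool) × (Fin L → Bool)
  have hΩ : (0 : ℝ) < Fintype.card Ω := Nat.cast_pos.2 Fintype.card_pos
  -- the total agreement over all triples
  have hsum : ∑ t : Fin L × Ω, agreement (nwPredictor e f D t.1 t.2.1 t.2.2) f =
      L * Fintype.card Ω * (1 / 2 + advantage D (nwGenerator e f) / L) := by
    have h := sum_predictorAgreement_div e f D hL
    rw [div_eq_iff hL'.ne'] at h
    rw [Fintype.sum_prod_type]
    have hinner : ∀ i : Fin L, ∑ p : Ω, agreement (nwPredictor e f D i p.1 p.2) f =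
        Fintype.card Ω * predictorAgreement e f D i := by
      intro i
      unfold predictorAgreement
      rw [mul_div_cancel₀ _ hΩ.ne']
    simp only [hinner, ← Finset.mul_sum, h]
    ring
  have havg := DirectProduct.card_filter_ge_of_sum_ge (univ : Finset (Fin L × Ω))
    (fun t => agreement (nwPredictor e f D t.1 t.2.1 t.2.2) f) (M := 1)
    (ρ := 1 / 2 + adv / L) (θ := 1 / 2 + adv / (2 * L)) one_pos (by positivity)
    (fun t _ => by
      unfold agreement
      rw [div_le_one (Nat.cast_pos.2 Fintype.card_pos)]
      exact_mod_cast (card_filter_le _ _).trans_eq card_univ)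
    (by
      rw [hsum, card_univ, Fintype.card_prod, Fintype.card_fin, Nat.cast_mul, mul_one]
      have : adv / L ≤ advantage D (nwGenerator e f) / L := div_le_div_of_nonneg_right hadv hL'.le
      nlinarith [mul_pos hL' hΩ])
  rw [card_univ] at havg
  simp only [mul_one] at havg
  refine le_trans (le_of_eq ?_) havg
  ring

end NW

/-! ### The amplified function `AMP(f) = (f^k)^{GL}` on bit positions -/

section Amp

variable {n k : ℕ}

/-- The input positions of `AMP(f)`: `k` blocks of `n` bits (the tuple `x⃗`) and `k` mask bits
(`r`). [cite: CarmosinoImpagliazzoKabanetsKolokolova2016, Thm. 4.3 (proof: "`(f^k)^{GL}` is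
defined on inputs of size `kn + k`")] -/
abbrev AmpIdx (n k : ℕ) : Type := (Fin k × Fin n) ⊕ Fin k

/-- The tuple `x⃗` read off an `AMP` input. [folklore] -/
def blocksOf (w : AmpIdx n k → Bool) : Fin k → (Fin n → Bool) := fun i j => w (Sum.inl (i, j))

/-- `Bool ↦ 𝔽₂`. [folklore] -/
def boolToZMod (b : Bool) : ZMod 2 := if b then 1 else 0

/-- The mask `r ∈ 𝔽₂^k` read off an `AMP` input. [folklore] -/
def maskOf (w : AmpIdx n k → Bool) : BVec k := fun i => boolToZMod (w (Sum.inr i))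

/-- **The amplified function** `AMP(f)(x⃗, r) = ⟨f^k(x⃗), r⟩` over `𝔽₂`, as a Boolean function of
the `kn + k` input bits. [cite: CarmosinoImpagliazzoKabanetsKolokolova2016, Thm. 4.3 (proof, steps 1–3)] -/
def ampFn (f : (Fin n → Bool) → Bool) (k : ℕ) : (AmpIdx n k → Bool) → Bool :=
  fun w => decide (dpGL f (blocksOf w, maskOf w) = 1)

/-- `𝔽₂ ↦ Bool` (is the element `1`?). [folklore] -/
def zmodToBool (c : ZMod 2) : Bool := decide (c = 1)

/-- `boolToZMod` and `zmodToBool` are inverse. [folklore] -/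
@[simp] theorem zmodToBool_boolToZMod (b : Bool) : zmodToBool (boolToZMod b) = b := by
  cases b <;> decide

/-- `boolToZMod` and `zmodToBool` are inverse. [folklore] -/
@[simp] theorem boolToZMod_zmodToBool (c : ZMod 2) : boolToZMod (zmodToBool c) = c := by
  fin_cases c <;> decide

/-- **The coordinate equivalence** between `AMP` inputs and pairs (tuple, mask). [folklore] -/
def ampEquiv (n k : ℕ) : (AmpIdx n k → Bool) ≃ (Fin k → (Fin n → Bool)) × BVec k where
  toFun w := (blocksOf w, maskOf w)
  invFun p := fun c => match c with
    | Sum.inl (i, j) => p.1 i j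
    | Sum.inr i => zmodToBool (p.2 i)
  left_inv w := by
    funext c
    rcases c with ⟨i, j⟩ | i
    · rfl
    · simp [maskOf]
  right_inv p := by
    rcases p with ⟨xs, r⟩
    refine Prod.ext ?_ ?_
    · funext i j; rfl
    · funext i; simp [maskOf]

/-- `AMP(f)` read through the equivalence is the GL bit. [folklore] -/
theorem ampFn_eq (f : (Fin n → Bool) → Bool) (w : AmpIdx n k → Bool) :
    ampFn f k w = zmodToBool (dpGL f (ampEquiv n k w)) := rfl

/-- A predictor agrees with `AMP(f)` at `w` iff its `𝔽₂`-value predicts the GL bit of the pair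
`ampEquiv w`. [folklore] -/
theorem eq_ampFn_iff (f : (Fin n → Bool) → Bool) (h : (AmpIdx n k → Bool) → Bool)
    (w : AmpIdx n k → Bool) : h w = ampFn f k w ↔ boolToZMod (h w) = dpGL f (ampEquiv n k w) := by
  rw [ampFn_eq]
  generalize dpGL f (ampEquiv n k w) = c
  generalize h w = b
  revert b c; decide

/-- Counting through an equivalence. [folklore] -/
theorem card_filter_univ_equiv {γ δ : Type*} [Fintype γ] [Fintype δ] (e : γ ≃ δ) (p : δ → Prop)
    [DecidablePred p] :
    (univ.filter fun c : γ => p (e c)).card = (univ.filter p).card := by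
  rw [← Finset.map_univ_equiv e, Finset.filter_map, Finset.card_map]
  rfl

/-- **Agreement with `AMP(f)` = predicting the GL bit of `f^k`**: the number of `AMP` inputs on
which `h` agrees with `AMP(f)` is the number of pairs `(x⃗, r)` on which
`boolToZMod ∘ h ∘ ampEquiv⁻¹` equals `⟨f^k(x⃗), r⟩` (the hypothesis of `card_goodSeedGuess_ge`).
[cite: CarmosinoImpagliazzoKabanetsKolokolova2016, Claim 4.4] -/
theorem card_agree_ampFn_eq (f : (Fin n → Bool) → Bool) (h : (AmpIdx n k → Bool) → Bool) :
    (univ.filter fun w : AmpIdx n k → Bool => h w = ampFn f k w).card =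
      (univ.filter fun p : (Fin k → (Fin n → Bool)) × BVec k =>
        boolToZMod (h ((ampEquiv n k).symm p)) = dpGL f p).card := by
  rw [← card_filter_univ_equiv (ampEquiv n k)]
  congr 1
  ext w
  simp only [mem_filter, mem_univ, true_and, Equiv.symm_apply_apply, eq_ampFn_iff]

/-- `|AMP inputs| = |tuples| · |masks|`. [folklore] -/
theorem card_ampIdx_fun (n k : ℕ) :
    Fintype.card (AmpIdx n k → Bool) = Fintype.card (Fin k → (Fin n → Bool)) * Fintype.card (BVec k) := by
  rw [Fintype.card_congr (ampEquiv n k), Fintype.card_prod]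

/-! ### `AMP(f)` on `Fin (k·n + k)` -/

/-- The bit positions of `AMP(f)` enumerated by `Fin (k·n + k)` (blocks first, then the mask).
[folklore] -/
def ampIdxEquiv (n k : ℕ) : AmpIdx n k ≃ Fin (k * n + k) :=
  (finProdFinEquiv.sumCongr (Equiv.refl (Fin k))).trans finSumFinEquiv

/-- `AMP(f)` as a function of `k·n + k` enumerated bits (the hard function fed to the NW
generator, CIKK proof of Thm. 3.2: "`f* = AMP(f)` is a function on `n' = poly(n, 1/ε)`
variables"). [cite: CarmosinoImpagliazzoKabanetsKolokolova2016, Thm. 3.2 (proof)] -/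
def ampFnFin (f : (Fin n → Bool) → Bool) (k : ℕ) : (Fin (k * n + k) → Bool) → Bool :=
  fun v => ampFn f k (v ∘ ampIdxEquiv n k)

end Amp

/-! ### Chaining conditional abundance over product spaces -/

/-- If at least a `p` fraction of `A` is good and, for every good `a`, at least a `q` fraction of
`B` is good for `a`, then at least a `p q` fraction of the pairs is good. [folklore] -/
theorem card_filter_prod_ge_mul {A B : Type*} [Fintype A] [Fintype B] [DecidableEq A]
    (GA : Finset A)
    (good : A → B → Prop) [∀ a b, Decidable (good a b)] {p q : ℝ} (hq : 0 ≤ q)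
    (hA : p * Fintype.card A ≤ GA.card)
    (hB : ∀ a ∈ GA, q * Fintype.card B ≤ ((univ.filter fun b => good a b).card : ℝ)) :
    p * q * (Fintype.card A * Fintype.card B) ≤
      ((univ.filter fun ab : A × B => ab.1 ∈ GA ∧ good ab.1 ab.2).card : ℝ) := by
  classical
  have hcount : ((univ.filter fun ab : A × B => ab.1 ∈ GA ∧ good ab.1 ab.2).card : ℝ) =
      ∑ a ∈ GA, ((univ.filter fun b => good a b).card : ℝ) := by
    rw [natCast_card_filter, Fintype.sum_prod_type, ← Finset.sum_subset (subset_univ GA)]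
    · refine Finset.sum_congr rfl fun a ha => ?_
      rw [natCast_card_filter]
      exact Finset.sum_congr rfl fun b _ => by simp [ha]
    · intro a _ ha
      exact Finset.sum_eq_zero fun b _ => by simp [ha]
  rw [hcount]
  have hB0 : (0 : ℝ) ≤ Fintype.card B := Nat.cast_nonneg _
  calc p * q * (Fintype.card A * Fintype.card B) = (p * Fintype.card A) * (q * Fintype.card B) := by
        ring
    _ ≤ GA.card * (q * Fintype.card B) := mul_le_mul_of_nonneg_right hA (mul_nonneg hq hB0)
    _ = ∑ _a ∈ GA, q * Fintype.card B := by rw [Finset.sum_const, nsmul_eq_mul]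
    _ ≤ ∑ a ∈ GA, ((univ.filter fun b => good a b).card : ℝ) := Finset.sum_le_sum hB

end Literature.Computability.Learning
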